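import Summits.Parity.GeneralizedHardyLittlewood.Theorems.LZZCertificateReplayLeaf
import Literature.NumberTheory.LFunctions.ZeroFreeRegionUpTo
import Literature.NumberTheory.LFunctions.LOneLowerBoundNonExceptional
import Literature.NumberTheory.LFunctions.NonExceptionalModuliPNT
import Literature.NumberTheory.LFunctions.ExplicitPNTNonExceptionalModuli
import Literature.NumberTheory.LFunctions.ExplicitLeastPrimeNonExceptionalModuli

/-!
# Route `LZZCertificateReplay` — what the kernel-replayed leaf gives the consumers (modulo Theorem 2.1)

The rung leaf `NoExceptionalZeroUpTo 400000 (1/5)` is proved in the kernel MODULO the single printed fact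
`LuZamanZhao2026.theorem21` (Lu–Zaman–Zhao, Math. Comp. 2026, Theorem 2.1):
`noExceptionalZeroUpTo_4e5_fifth_of_theorem21` (`LZZCertificateReplayLeaf.lean`). This file instantiates the
cell's typed CONSUMERS (PROOF-OF-DATA.md §2; all landed as Literature theorems taking a
`NoExceptionalZeroUpTo Q c₀` table as hypothesis) at that leaf, so that each reads as an implication from
named facts only — `theorem21`, plus McCurley's Theorem 1 / Bennett–Martin–O'Bryant–Rechnitzer's Lemma 6.12
where the consumer itself is conditional on those:

* `lzzReplay_zeroFreeRegionUpTo_of` — the EXCEPTION-FREE McCurley region up to `4·10⁵`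
  (`ZeroFreeRegionUpTo 400000 9.645908801 10`);
* `lzzReplay_corollary12_of` — Lu–Zaman–Zhao's Corollary 1.2 shape for `3 ≤ q ≤ 4·10⁵`: `L(s, χ) ≠ 0` for every
  `χ` mod `q`, `s ≠ 1`, `Re s ≥ 1 − 1/(10 log max(q, q|Im s|, 10))`;
* `lzzReplay_lfunction_one_re_ge_of` — `Re L(1, χ) ≥ κ/log q` with the explicit `κ` of
  `NoExceptionalZeroUpTo.lfunction_one_re_ge` at `c₀ = 1/5`, for quadratic `χ ≠ χ₀` mod `3 ≤ q ≤ 4·10⁵`;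
* `lzzReplay_chebyshevPsiMod_bound_of` — Page–Siegel–Walfisz for all `q ≤ 4·10⁵` with ABSOLUTE constants;
* `lzzReplay_psi_bound_of`, `lzzReplay_exists_prime_le_of` — the explicit `ψ(x; q, a)` bound and the least
  prime `p ≡ a (q)`, `p ≤ exp(max(4R₁ log² q, √q))`, for `10⁵ ≤ q ≤ 4·10⁵`.

In print these statements for `q ≤ 4·10⁵` rest on Platt's numerical GRH verification (`platt2016_theorem71`,
the tree's `…_platt` instances); here the numerical input is the kernel replay of the Lu–Zaman–Zhao
certificates instead, and the only unverified input is the 14-page analytic Theorem 2.1. Every theorem below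
is CONDITIONAL (hypothesis `h21`); nothing is computed here. WHAT THIS IS NOT: no statement beyond
`q = 4·10⁵`, no claim about Siegel zeros in general.
-/

namespace Summit.Parity.GeneralizedHardyLittlewood.Theorems

open Literature.NumberTheory.LFunctions
open Literature.NumberTheory.LFunctions.Siegel Literature.NumberTheory.LFunctions.Estermann

/-- **Exception-free McCurley region up to `4·10⁵`, modulo Theorem 2.1 and McCurley's Theorem 1**:
`ZeroFreeRegionUpTo 400000 9.645908801 10` (every `χ` mod `3 ≤ q ≤ 4·10⁵` is zero-free in McCurley's open
region; the possible exceptional real zero is excluded by the replayed certificates since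
`9.645908801 · (1/5) ≥ 1`). -/
theorem lzzReplay_zeroFreeRegionUpTo_of (h21 : LuZamanZhao2026.theorem21) (hM : McCurley1984_theorem1) :
    ZeroFreeRegionUpTo 400000 9.645908801 10 :=
  zeroFreeRegionUpTo_of_noExceptionalZeroUpTo hM (by norm_num)
    (noExceptionalZeroUpTo_4e5_fifth_of_theorem21 h21) le_rfl (by norm_num) (by norm_num)

/-- **Corollary-1.2 shape up to `4·10⁵`, modulo Theorem 2.1 and McCurley's Theorem 1**: for every modulus
`3 ≤ q ≤ 4·10⁵`, every Dirichlet character `χ` mod `q` and every `s ≠ 1` with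
`Re s ≥ 1 − 1/(10 log max(q, q|Im s|, 10))`, `L(s, χ) ≠ 0` (the closed `c = 1/10` region lies inside
McCurley's open region with `R₁ = 9.645908801 < 10`). Same argument as
`luZamanZhao2026_corollary12_of`, with the kernel replay in place of Theorem 1.1. -/
theorem lzzReplay_corollary12_of (h21 : LuZamanZhao2026.theorem21) (hM : McCurley1984_theorem1)
    {q : ℕ} [NeZero q] (hq3 : 3 ≤ q) (hqQ : q ≤ 400000) (χ : DirichletCharacter ℂ q) {s : ℂ}
    (hs : s ≠ 1) (hr : 1 - 1 / (10 * Real.log (max (max (q : ℝ) ((q : ℝ) * |s.im|)) 10)) ≤ s.re) :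
    χ.LFunction s ≠ 0 := by
  have hZ := lzzReplay_zeroFreeRegionUpTo_of h21 hM
  refine hZ q hq3 hqQ χ s hs (lt_of_lt_of_le ?_ hr)
  have hM10 : (10 : ℝ) ≤ max (max (q : ℝ) ((q : ℝ) * |s.im|)) 10 := le_max_right _ _
  have hlogM : 0 < Real.log (max (max (q : ℝ) ((q : ℝ) * |s.im|)) 10) :=
    Real.log_pos (by linarith)
  have h1 : 1 / (10 * Real.log (max (max (q : ℝ) ((q : ℝ) * |s.im|)) 10)) <
      1 / (9.645908801 * Real.log (max (max (q : ℝ) ((q : ℝ) * |s.im|)) 10)) := by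
    apply one_div_lt_one_div_of_lt
    · positivity
    · nlinarith
  linarith

/-- **`L(1, χ)` lower bound up to `4·10⁵`, modulo Theorem 2.1**: for every quadratic `χ ≠ χ₀` mod
`3 ≤ q ≤ 4·10⁵`, `estermannC · (1/5) · exp(−estermannA · (1/5) · (1 + log ballConst)) / log q ≤ Re L(1, χ)`
(`NoExceptionalZeroUpTo.lfunction_one_re_ge` at `c₀ = 1/5`, where `min(1/5, 1/4) = 1/5`). -/
theorem lzzReplay_lfunction_one_re_ge_of (h21 : LuZamanZhao2026.theorem21) {q : ℕ} [NeZero q]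
    (hq3 : 3 ≤ q) (hqQ : q ≤ 400000) (χ : DirichletCharacter ℂ q) (hquad : χ.IsQuadratic) (hχ : χ ≠ 1) :
    estermannC * min (1 / 5 : ℝ) (1 / 4) *
        Real.exp (-(estermannA * min (1 / 5 : ℝ) (1 / 4) * (1 + Real.log ballConst))) / Real.log q ≤
      (χ.LFunction 1).re :=
  NoExceptionalZeroUpTo.lfunction_one_re_ge (noExceptionalZeroUpTo_4e5_fifth_of_theorem21 h21)
    (by norm_num) hq3 hqQ χ hquad hχ

/-- **Page–Siegel–Walfisz for all `q ≤ 4·10⁵` with absolute constants, modulo Theorem 2.1**: there are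
`k, m > 0` with `|ψ(x; q, a) − x/φ(q)| ≤ k · (q (1 + log q)⁵/φ(q)) · x · exp(−m √(log x)/(1 + log q))` for
every `1 ≤ q ≤ 4·10⁵`, every unit `a` mod `q`, every `x ≥ 2` — no exceptional modulus, no Siegel constant
(`chebyshevPsiMod_bound_of_noExceptionalZeroUpTo` at `c₀ = 1/5`). -/
theorem lzzReplay_chebyshevPsiMod_bound_of (h21 : LuZamanZhao2026.theorem21) :
    ∃ k m : ℝ, 0 < k ∧ 0 < m ∧ ∀ q : ℕ, 1 ≤ q → q ≤ 400000 → ∀ (a : (ZMod q)ˣ) (x : ℝ), 2 ≤ x →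
      |Literature.NumberTheory.Sieve.ParityWave0.chebyshevPsiMod q a x - x / q.totient| ≤
        k * ((q : ℝ) * (1 + Real.log q) ^ 5 / q.totient) * x *
          Real.exp (-(m * Real.sqrt (Real.log x) / (1 + Real.log q))) := by
  obtain ⟨k, m, hk, hm, h⟩ := chebyshevPsiMod_bound_of_noExceptionalZeroUpTo (c₀ := 1 / 5) (by norm_num)
  exact ⟨k, m, hk, hm, h 400000 (noExceptionalZeroUpTo_4e5_fifth_of_theorem21 h21)⟩

/-- **Explicit `ψ(x; q, a)` bound for `10⁵ ≤ q ≤ 4·10⁵`, modulo Theorem 2.1 and BMOR Lemma 6.12**: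
`|ψ(x; q, a) − x/φ(q)| ≤ 1.4579 · x · √(log x/R₁) · exp(−√(log x/R₁))` for `x ≥ exp(4R₁ log² q)`,
`R₁ = 9.645908801` (`1/R₁ ≤ 1/5`). In print (Bennett–Martin–O'Bryant–Rechnitzer, Prop. 6.18) this range rests
on Platt's computation. -/
theorem lzzReplay_psi_bound_of (h21 : LuZamanZhao2026.theorem21) (h612 : BMOR2018.lemma612_psi)
    {q : ℕ} [NeZero q] (hq : 10 ^ 5 ≤ q) (hqQ : q ≤ 400000) (a : (ZMod q)ˣ) {x : ℝ}
    (hx : Real.exp (4 * BMOR2018.R₁ * Real.log q ^ 2) ≤ x) :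
    |Literature.NumberTheory.Sieve.ParityWave0.chebyshevPsiMod q a x - x / q.totient| ≤
      BMOR2018.errTerm x :=
  BMOR2018.psi_bound_of_noExceptionalZeroUpTo h612 (noExceptionalZeroUpTo_4e5_fifth_of_theorem21 h21)
    (by unfold BMOR2018.R₁; norm_num) hq hqQ a hx

/-- **Least prime in a progression for `10⁵ ≤ q ≤ 4·10⁵`, modulo Theorem 2.1 and BMOR Lemma 6.12 (θ form)**:
for every reduced class `a` mod `q` there is a prime `p ≡ a (mod q)` with `p ≤ exp(max(4R₁ log² q, √q))`. -/
theorem lzzReplay_exists_prime_le_of (h21 : LuZamanZhao2026.theorem21) (h612 : BMOR2018.lemma612_theta)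
    {q : ℕ} [NeZero q] (hq : 10 ^ 5 ≤ q) (hqQ : q ≤ 400000) (a : (ZMod q)ˣ) :
    ∃ p : ℕ, p.Prime ∧ (p : ZMod q) = a ∧
      (p : ℝ) ≤ Real.exp (max (4 * BMOR2018.R₁ * Real.log q ^ 2) (Real.sqrt q)) :=
  BMOR2018.exists_prime_le_of_noExceptionalZeroUpTo h612 (noExceptionalZeroUpTo_4e5_fifth_of_theorem21 h21)
    (by unfold BMOR2018.R₁; norm_num) hq hqQ a

end Summit.Parity.GeneralizedHardyLittlewood.Theorems
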